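import Mathlib
import HarnessLib

/-!
# Rankin's trick for the harmonic tail of the smooth numbers

Topic `Literature/NumberTheory/Multiplicative`. PROOF file (theorems only; no definition, no named fact), proved from
Mathlib alone (the Euler product over the `N`-smooth numbers for a completely multiplicative weight,
`EulerProduct.summable_and_hasSum_smoothNumbers_prod_primesBelow_geometric`).  Rankin's method (1938): for
`0 ≤ σ < 1` the weight `m ↦ m^{σ−1}` is completely multiplicative with `p^{σ−1} < 1`, so its sum over ALL `N`-smooth
numbers is the finite Euler product `Π_{p<N}(1 − p^{σ−1})⁻¹`, and `1/m ≤ Y^{−σ}·m^{σ−1}` for `m ≥ Y` turns this into a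
bound for the harmonic mass of the smooth numbers beyond `Y`:

* `sum_rpow_smooth_le_prod` — `Σ_{m ≤ X, m N-smooth} m^{σ−1} ≤ Π_{p<N}(1 − p^{σ−1})⁻¹` (`σ < 1`);
* **`sum_inv_smooth_tail_le`** — `Σ_{Y ≤ m ≤ X, m N-smooth} 1/m ≤ Y^{−σ}·Π_{p<N}(1 − p^{σ−1})⁻¹` (`0 ≤ σ < 1`, `1 ≤ Y`)
  (Tenenbaum, Ch. III.5, §5.1, the proof of Thm. 5.1 with the harmonic weight; Rankin 1938).

With `σ = c/log N` the product is `≤ exp(e^c·Σ_{p<N}1/p) ≍ (log N)^{e^c}` and the tail beyond `Y = N^u` decays like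
`e^{−cu}`: the elementary exponential smallness of the harmonic mass of very smooth numbers used e.g. in
rh-explicit A6-PIVOT (CONTINUUM-LIMIT §28.2) for the window mass `ε_u` of the smooth cells.

References: G. Tenenbaum, *Introduction to Analytic and Probabilistic Number Theory*, 3rd ed., AMS GSM 163 (2015),
Ch. III.5 [Tenenbaum2015]; R. A. Rankin, *The difference between consecutive prime numbers*, J. London Math. Soc.
13 (1938) 242–247.
-/

noncomputable section

open Finset

namespace Literature.NumberTheory.Multiplicative.SmoothRankin

/-- The weight `n ↦ n^{σ−1}` is completely multiplicative (Rankin's weight). [cite: Tenenbaum2015, Ch. III.5 §5.1] -/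
theorem rpow_weight_mul (σ : ℝ) (m n : ℕ) :
    ((m * n : ℕ) : ℝ) ^ (σ - 1) = (m : ℝ) ^ (σ - 1) * (n : ℝ) ^ (σ - 1) := by
  push_cast
  exact Real.mul_rpow (Nat.cast_nonneg m) (Nat.cast_nonneg n)

/-- **The finite Euler product bounds the partial sums**: for `σ < 1` and all `N, X`,
`Σ_{m ≤ X, m N-smooth} m^{σ−1} ≤ Π_{p<N}(1 − p^{σ−1})⁻¹`. [cite: Tenenbaum2015, Ch. III.5 §5.1] -/
theorem sum_rpow_smooth_le_prod (N X : ℕ) {σ : ℝ} (hσ : σ < 1) :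
    ∑ m ∈ (Icc 1 X).filter (· ∈ Nat.smoothNumbers N), (m : ℝ) ^ (σ - 1) ≤
      ∏ p ∈ N.primesBelow, (1 - (p : ℝ) ^ (σ - 1))⁻¹ := by
  let f : ℕ →* ℝ :=
    { toFun := fun n => (n : ℝ) ^ (σ - 1)
      map_one' := by simp
      map_mul' := fun m n => rpow_weight_mul σ m n }
  have hf : ∀ n : ℕ, f n = (n : ℝ) ^ (σ - 1) := fun _ => rfl
  have hlt : ∀ {p : ℕ}, p.Prime → ‖f p‖ < 1 := by
    intro p hp
    have hp1 : (1 : ℝ) < p := by exact_mod_cast hp.one_lt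
    rw [hf, Real.norm_eq_abs, abs_of_nonneg (Real.rpow_nonneg (by linarith) _)]
    exact Real.rpow_lt_one_of_one_lt_of_neg hp1 (by linarith)
  obtain ⟨-, hsum⟩ := EulerProduct.summable_and_hasSum_smoothNumbers_prod_primesBelow_geometric hlt N
  have hind : HasSum ((Nat.smoothNumbers N).indicator (fun n : ℕ => (f n : ℝ)))
      (∏ p ∈ N.primesBelow, (1 - f p)⁻¹) := hasSum_subtype_iff_indicator.1 hsum
  have hnn : ∀ n, 0 ≤ (Nat.smoothNumbers N).indicator (fun n : ℕ => (f n : ℝ)) n := by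
    intro n
    by_cases hn : n ∈ Nat.smoothNumbers N
    · rw [Set.indicator_of_mem hn, hf]; exact Real.rpow_nonneg (Nat.cast_nonneg n) _
    · rw [Set.indicator_of_notMem hn]
  have hle := sum_le_hasSum (Icc 1 X) (fun n _ => hnn n) hind
  have hlhs : ∑ m ∈ (Icc 1 X).filter (· ∈ Nat.smoothNumbers N), (m : ℝ) ^ (σ - 1) =
      ∑ n ∈ Icc 1 X, (Nat.smoothNumbers N).indicator (fun n : ℕ => (f n : ℝ)) n := by
    rw [Finset.sum_filter]
    refine Finset.sum_congr rfl fun n _ => ?_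
    by_cases hn : n ∈ Nat.smoothNumbers N
    · rw [if_pos hn, Set.indicator_of_mem hn, hf]
    · rw [if_neg hn, Set.indicator_of_notMem hn]
  have hrhs : ∏ p ∈ N.primesBelow, (1 - f p)⁻¹ = ∏ p ∈ N.primesBelow, (1 - (p : ℝ) ^ (σ - 1))⁻¹ :=
    Finset.prod_congr rfl fun p _ => by rw [hf]
  rw [hlhs, ← hrhs]
  exact hle

/-- **Rankin's trick for the harmonic tail of the smooth numbers**: for `0 ≤ σ < 1`, `1 ≤ Y` and all `N, X`,
`Σ_{m ≤ X, m N-smooth, Y ≤ m} 1/m ≤ Y^{−σ}·Π_{p<N}(1 − p^{σ−1})⁻¹`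
(`1/m = m^{σ−1}·m^{−σ} ≤ m^{σ−1}·Y^{−σ}` for `m ≥ Y`). [cite: Tenenbaum2015, Ch. III.5 §5.1] -/
theorem sum_inv_smooth_tail_le (N X : ℕ) {σ Y : ℝ} (hσ0 : 0 ≤ σ) (hσ : σ < 1) (hY : 1 ≤ Y) :
    ∑ m ∈ ((Icc 1 X).filter (· ∈ Nat.smoothNumbers N)).filter (fun m : ℕ => Y ≤ (m : ℝ)), (1 : ℝ) / m ≤
      Y ^ (-σ) * ∏ p ∈ N.primesBelow, (1 - (p : ℝ) ^ (σ - 1))⁻¹ := by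
  have hY0 : 0 < Y := by linarith
  -- termwise: 1/m ≤ Y^{-σ} m^{σ-1}
  have hterm : ∀ m ∈ ((Icc 1 X).filter (· ∈ Nat.smoothNumbers N)).filter (fun m : ℕ => Y ≤ (m : ℝ)),
      (1 : ℝ) / m ≤ Y ^ (-σ) * (m : ℝ) ^ (σ - 1) := by
    intro m hm
    have hYm : Y ≤ (m : ℝ) := (Finset.mem_filter.1 hm).2
    have hm0 : (0 : ℝ) < m := hY0.trans_le hYm
    -- m^{-σ} ≤ Y^{-σ}
    have h1 : (m : ℝ) ^ (-σ) ≤ Y ^ (-σ) := Real.rpow_le_rpow_of_nonpos hY0 hYm (by linarith)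
    have h2 : (1 : ℝ) / m = (m : ℝ) ^ (-σ) * (m : ℝ) ^ (σ - 1) := by
      rw [← Real.rpow_add hm0, show -σ + (σ - 1) = (-1 : ℝ) by ring, Real.rpow_neg_one, one_div]
    rw [h2]
    exact mul_le_mul_of_nonneg_right h1 (Real.rpow_nonneg hm0.le _)
  refine (Finset.sum_le_sum hterm).trans ?_
  rw [← Finset.mul_sum]
  refine mul_le_mul_of_nonneg_left ?_ (Real.rpow_nonneg hY0.le _)
  refine le_trans ?_ (sum_rpow_smooth_le_prod N X hσ)
  exact Finset.sum_le_sum_of_subset_of_nonneg (Finset.filter_subset _ _)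
    fun m _ _ => Real.rpow_nonneg (Nat.cast_nonneg m) _

/-- The Euler product in exponential form: for `σ < 1` and `N ≥ 1`,
`Π_{p<N}(1 − p^{σ−1})⁻¹ ≤ exp(Σ_{p<N} p^{σ−1}/(1 − 2^{σ−1}))` (`(1 − t)⁻¹ ≤ exp(t/(1 − t₀))` for `0 ≤ t ≤ t₀ < 1`).
[cite: Tenenbaum2015, Ch. III.5 §5.1] -/
theorem prod_inv_one_sub_rpow_le_exp (N : ℕ) {σ : ℝ} (hσ : σ < 1) :
    ∏ p ∈ N.primesBelow, (1 - (p : ℝ) ^ (σ - 1))⁻¹ ≤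
      Real.exp ((∑ p ∈ N.primesBelow, (p : ℝ) ^ (σ - 1)) / (1 - (2 : ℝ) ^ (σ - 1))) := by
  have h2 : (2 : ℝ) ^ (σ - 1) < 1 := Real.rpow_lt_one_of_one_lt_of_neg (by norm_num) (by linarith)
  have hden : 0 < 1 - (2 : ℝ) ^ (σ - 1) := by linarith
  rw [Finset.sum_div, Real.exp_sum]
  refine Finset.prod_le_prod (fun p hp => ?_) (fun p hp => ?_)
  · have hp := (Nat.mem_primesBelow.1 hp).2
    have : (p : ℝ) ^ (σ - 1) < 1 :=
      Real.rpow_lt_one_of_one_lt_of_neg (by exact_mod_cast hp.one_lt) (by linarith)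
    have : 0 < 1 - (p : ℝ) ^ (σ - 1) := by linarith
    positivity
  · have hp := (Nat.mem_primesBelow.1 hp).2
    set t := (p : ℝ) ^ (σ - 1) with ht
    have ht0 : 0 ≤ t := Real.rpow_nonneg (Nat.cast_nonneg p) _
    have htp : t ≤ (2 : ℝ) ^ (σ - 1) :=
      Real.rpow_le_rpow_of_nonpos (by norm_num) (by exact_mod_cast hp.two_le) (by linarith)
    have ht1 : 0 < 1 - t := by linarith
    -- (1 - t)⁻¹ ≤ exp(t/(1 - 2^{σ-1})): from 1 - t ≥ exp(-t/(1-t₀))?  Use log: -log(1-t) ≤ t/(1-t) ≤ t/(1-t₀).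
    rw [← Real.exp_log (inv_pos.2 ht1), Real.log_inv]
    refine Real.exp_le_exp.2 ?_
    have hlog : -Real.log (1 - t) ≤ t / (1 - t) := by
      -- log(1-t) ≥ 1 - 1/(1-t) = -t/(1-t)  (log x ≥ 1 - 1/x for x > 0)
      have h := Real.one_sub_inv_le_log_of_pos ht1
      have e : 1 - (1 - t)⁻¹ = -(t / (1 - t)) := by field_simp; ring
      rw [e] at h
      linarith
    calc -Real.log (1 - t) ≤ t / (1 - t) := hlog
      _ ≤ t / (1 - (2 : ℝ) ^ (σ - 1)) := div_le_div_of_nonneg_left ht0 hden (by linarith)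

end Literature.NumberTheory.Multiplicative.SmoothRankin

end
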